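import Summits.CriticalPhenomena.PercolationContinuityZ3.Theorems.Transplant.FKConnectivityAllQPairApex
import Summits.CriticalPhenomena.PercolationContinuityZ3.Theorems.Transplant.FKConnectivityAllQSPNegDep
import HarnessLib

/-!
# Connectivity correlation inequalities for `φ_{w,q}`, every `q > 0` — the PAIR–APEX node holds on every two-terminal
# series–parallel support, and with it ALR's hub inequality (14) at an SP-terminal hub for an ARBITRARY apex

Theorems file (`--supports stmt-CriticalPhenomena-4575`), census lineage `prim-bschramm-census` (gen 26) of the post-continuity
programme; builds on p205010 (kernel theorem, internal audit signed; external expert review pending).  No definitions, no named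
facts, no sorries; standard axioms.

THE OBSERVATION.  Census gen 24/25's pair–apex row `δ = m₀m₄ − m₁(m₂+m₃) ≥ 0` (`PairApexUnder μ z s t`:
`μ(s ↔ t)·μ(z ↔ s ∪ z ↔ t) ≤ μ(Ω)·μ((s ↔ t) ∩ (z ↔ s ∪ z ↔ t))`, file `…PairApex.lean`) is the UP-CORRELATION of the terminal
connection `{s ↔ t}` with the INCREASING event `{z ↔ s} ∪ {z ↔ t}`.  On a two-terminal series–parallel network between `s` and `t`
(`FK.IsTTSP E s t`, weights supported in `E`) conditioning on `{s ↔ t}` raises every increasing event for every `q > 0` — fk-2's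
`FK.connUpCorr_of_isTTSP` (Wagner's Rayleigh monotonicity ⇒ (UPC-net)).  Hence the pair–apex node holds on that class for EVERY position
of the apex `z` (`pairApexUnder_of_isTTSP`), and therefore so does Ayyer–Linusson–Ravichandran's hub inequality (14)
`φ(z ↔ s)·φ(t ↔ s) ≤ φ(z ↔ s ↔ t)` with the hub at either SP terminal and the third vertex arbitrary
(`hubUnder_apex_of_isTTSP`, `hubUnder_apex_of_isTTSP'`) — the existing `FK.hubUnder_of_isTTSP` asks BOTH pairs `(o,a)`, `(b,a)` to be
SP-terminal pairs of `E`.  In the weight-free language of `…AntipodalPolar.lean` this is the census-g26 remark that Conjecture T is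
`½·apPsi q E 1_{s↔t} 1_{z↔{s,t}} ≥ 0`, i.e. Theorem U's conclusion for one particular monotone test function, asked on every graph.
[cite: AyyerLinussonRavichandran2025, §7 eq. (13)–(15), Conj. 7.1 (p. 22)] [cite: Grimmett2006, Thm. (3.8) (p. 39); §3.8 Thm. (3.90) (pp. 61–62); §3.9 (pp. 63–64)]
[cite: Wagner2006, Thm. 5.8(d), §5.3]
-/

noncomputable section

namespace Summit.CriticalPhenomena.PercolationContinuityZ3.Theorems

namespace FK

open MeasureTheory Set Literature.Probability.LatticeModels Literature.Probability.Percolation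
open scoped Classical

variable {V : Type*} [Fintype V]

/-- **The pair–apex node on two-terminal series–parallel supports, every `q > 0`**: if `E` is a two-terminal series–parallel
network between `s` and `t` and `w` is supported in `E`, then for every vertex `z`,
`φ_{w,q}(s ↔ t)·φ_{w,q}(z ↔ s ∪ z ↔ t) ≤ φ_{w,q}((s ↔ t) ∩ (z ↔ s ∪ z ↔ t))` — census gen 24's `δ ≥ 0` on this class
(`{z ↔ s} ∪ {z ↔ t}` is increasing; apply `FK.connUpCorr_of_isTTSP`).
[cite: AyyerLinussonRavichandran2025, §7 eq. (14) (p. 22)] [cite: Grimmett2006, §3.8 Thm. (3.90) (pp. 61–62); §3.9 (pp. 63–64)]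
[cite: Wagner2006, Thm. 5.8(d), §5.3] -/
theorem pairApexUnder_of_isTTSP {q : ℝ} (hq : 0 < q) {E : Finset (Sym2 V)} {s t : V} (hE : IsTTSP E s t)
    (w : Sym2 V → unitInterval) (hw : ∀ e, ((w e : unitInterval) : ℝ) ≠ 0 → e ∈ (↑E : Set (Sym2 V))) (z : V) :
    PairApexUnder (rcMeasureW w q ∅) z s t := by
  haveI := isProbabilityMeasure_rcMeasureW w hq (∅ : Set V)
  unfold PairApexUnder
  rw [probReal_univ, one_mul]
  exact connUpCorr_of_isTTSP hq hE w hw ((isUpperSet_openConn z s).union (isUpperSet_openConn z t))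

/-- **ALR's hub inequality (14) at an SP terminal, arbitrary apex, every `q > 0`**: if `E` is a two-terminal series–parallel
network between `s` and `t` and `w` is supported in `E`, then for every vertex `z`,
`φ_{w,q}(z ↔ s)·φ_{w,q}(t ↔ s) ≤ φ_{w,q}(z ↔ s ∩ t ↔ s)` (hub `s`, arms `z` and `t`; only the pair `(s,t)` is required to be the
terminal pair of the network). [cite: AyyerLinussonRavichandran2025, §7 eq. (13)–(14) (p. 22)] [cite: Grimmett2006, §3.9 (pp. 63–64)] -/
theorem hubUnder_apex_of_isTTSP {q : ℝ} (hq : 0 < q) {E : Finset (Sym2 V)} {s t : V} (hE : IsTTSP E s t)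
    (w : Sym2 V → unitInterval) (hw : ∀ e, ((w e : unitInterval) : ℝ) ≠ 0 → e ∈ (↑E : Set (Sym2 V))) (z : V) :
    HubUnder (rcMeasureW w q ∅) z s t := by
  haveI := isProbabilityMeasure_rcMeasureW w hq (∅ : Set V)
  exact hubUnder_of_pairApexUnder _ z s t (pairApexUnder_of_isTTSP hq hE w hw z)

/-- **ALR's hub inequality (14) at the other SP terminal**: under the same hypotheses, for every vertex `z`,
`φ_{w,q}(z ↔ t)·φ_{w,q}(s ↔ t) ≤ φ_{w,q}(z ↔ t ∩ s ↔ t)` (hub `t`).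
[cite: AyyerLinussonRavichandran2025, §7 eq. (13)–(14) (p. 22)] [cite: Grimmett2006, §3.9 (pp. 63–64)] -/
theorem hubUnder_apex_of_isTTSP' {q : ℝ} (hq : 0 < q) {E : Finset (Sym2 V)} {s t : V} (hE : IsTTSP E s t)
    (w : Sym2 V → unitInterval) (hw : ∀ e, ((w e : unitInterval) : ℝ) ≠ 0 → e ∈ (↑E : Set (Sym2 V))) (z : V) :
    HubUnder (rcMeasureW w q ∅) z t s :=
  hubUnder_apex_of_isTTSP hq hE.symm w hw z

end FK

end Summit.CriticalPhenomena.PercolationContinuityZ3.Theorems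

end
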